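import Summits.CriticalPhenomena.Ising3DConformalLimit.Theorems.StrandShadow.Negative.ClusterDecomposition
import Literature.Uncategorized.PairSplitDeletionIdentity

/-!
# `StrandShadow` (item stmt-CriticalPhenomena-14626): the pair-split deletion identity (★)

Standing crux disprover (refuter-cdisprove-stmt-CriticalPhenomena-14626-0), cycle 1 — SUPPORT file 2/2
(file 1/2: `ClusterDecomposition.lean`).  No Theses decl is concluded.

For a finite graph `G`, real `β` (`t = tanh β`), and four vertices `a₀,…,a₃`:
`Σ_{F₁ ∈ 𝒯₀₁(G), a₂,a₃ ∉ V(K_{a₀}F₁)} t^|F₁| · ⟨σ_{a₂}σ_{a₃}⟩^free_{G, V ∖ V(K_{a₀}F₁); β, 0}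
   = Σ_{F ∈ 𝒯_{0123}(G), a₂,a₃ ∉ V(K_{a₀}F)} t^|F|`                                   (★)
(`pairSplit_identity`; `pairSplit_identity_fin4` in the route's `Fin 4` dress, which DISCHARGES the named
fact `Literature.Uncategorized.PairSplitDeletionIdentity`, `pairSplitDeletionIdentity_holds`).  Proof: the outer sum
decomposes over the cluster index set (`sum_clean_eq_sum_fibres`), each fibre is evaluated by
`fibre_sum` (file 1/2) and the high-temperature expansion `isingCorr_free_eq_hteSum_div`
(`fibre_pair_side`, `fibre_four_side`).  Also the LoopO1 ↔ HT-expansion bridges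
(`tJoins_univ_eq_filter`, `loopO1PartitionFunction_eq_hteSum`, `loopO1PartitionFunction_eq_sum_tJoins`,
`isingCorr_univ_free_eq_loopO1_div`, `loopO1PartitionFunction_empty_pos'`).
Consequence (with the tetrahedral symmetry of the route's frame, see `CostumeReduction.lean`): the
junk-free shadow ratio of the crux is `(1 - (2/3)·Int)(1 - P_C)` exactly, so the clean crux is the
lattice clause (iii) at the tetrahedron in deletion dress.
-/

noncomputable section

namespace Summit.CriticalPhenomena.Ising3DConformalLimit.StrandShadowNegative

open scoped BigOperators Classical
open Finset Literature.Probability.LatticeModels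

/-! ### Assembly of (★) -/

section Assembly

variable {V : Type*} [Fintype V] [DecidableEq V] (G : SimpleGraph V) [DecidableRel G.Adj]


omit [Fintype V] in
/-- Parity transfer between `F` and its `a₀`-cluster at a reachable vertex. [folklore] -/
theorem odd_edeg_clusterEdges_iff {F : Finset (Sym2 V)} {a₀ v : V} (hv : Rch F a₀ v) :
    Odd (edeg (clusterEdges F a₀) v) ↔ Odd (edeg F v) := by
  have hsplit : edeg F v = edeg (clusterEdges F a₀) v + edeg (F \ clusterEdges F a₀) v := by
    rw [← edeg_union disjoint_sdiff, union_sdiff_of_subset (clusterEdges_subset F a₀)]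
  have h0 : edeg (F \ clusterEdges F a₀) v = 0 :=
    edeg_eq_zero_of_avoid fun e he hve =>
      sdiff_clusterEdges_avoid F a₀ e he v hve ((rch_clusterEdges_iff F a₀ v).2 hv)
  rw [hsplit, h0, add_zero]

omit [Fintype V] in
/-- Unreachable vertices have degree `0` in the `a₀`-cluster. [folklore] -/
theorem edeg_clusterEdges_eq_zero {F : Finset (Sym2 V)} {a₀ v : V} (hv : ¬ Rch F a₀ v) :
    edeg (clusterEdges F a₀) v = 0 :=
  edeg_eq_zero_of_not_rch (clusterEdges_idem F a₀) (by rwa [rch_clusterEdges_iff])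

/-- In a `T`-join whose terminals other than `a₀, a₁` are unreachable from `a₀`, the terminal
`a₁` IS reachable (handshake inside the `a₀`-cluster). [folklore] -/
theorem rch_a1 {S' : Finset V} {a₀ a₁ : V} (ha₀ : a₀ ∈ S') {F : Finset (Sym2 V)}
    (hS' : ∀ v ∈ S', Rch F a₀ v → v = a₀ ∨ v = a₁)
    (hF : F ∈ tJoins G Set.univ S') : Rch F a₀ a₁ := by
  by_contra hn
  rw [mem_tJoins_univ] at hF
  obtain ⟨hFG, hFodd⟩ := hF
  set K := clusterEdges F a₀ with hKdef
  have hdiag : ∀ e ∈ K, ¬ e.IsDiag := fun e he =>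
    SimpleGraph.not_isDiag_of_mem_edgeSet G
      (SimpleGraph.mem_edgeFinset.1 (hFG (clusterEdges_subset F a₀ he)))
  have heven := even_card_odd_edeg hdiag
  have hO : (univ.filter fun v => Odd (edeg K v)) = {a₀} := by
    ext v
    simp only [mem_filter, mem_univ, true_and, mem_singleton]
    by_cases hv : Rch F a₀ v
    · rw [hKdef, odd_edeg_clusterEdges_iff hv, hFodd v]
      constructor
      · intro hvS
        rcases hS' v hvS hv with h | h
        · exact h
        · exact absurd (h ▸ hv) hn
      · rintro rfl; exact ha₀
    · rw [hKdef, edeg_clusterEdges_eq_zero hv]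
      constructor
      · intro h; exact absurd h Nat.not_odd_zero
      · rintro rfl; exact absurd (rch_refl F v) hv
  rw [hO, card_singleton] at heven
  exact Nat.not_even_one heven

/-- The `a₀`-cluster of a clean `T`-join lies in the cluster index set. [folklore] -/
theorem clusterEdges_mem_clusterIndex {S' : Finset V} {a₀ a₁ a₂ a₃ : V}
    (ha₀ : a₀ ∈ S') (ha₁ : a₁ ∈ S') (hS' : ∀ v ∈ S', v ≠ a₀ → v ≠ a₁ → v = a₂ ∨ v = a₃)
    {F : Finset (Sym2 V)} (hF : F ∈ tJoins G Set.univ S') (h2 : ¬ Rch F a₀ a₂)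
    (h3 : ¬ Rch F a₀ a₃) : clusterEdges F a₀ ∈ clusterIndex G a₀ a₁ a₂ a₃ := by
  have hreach : ∀ v ∈ S', Rch F a₀ v → v = a₀ ∨ v = a₁ := by
    intro v hv hr
    by_cases h0 : v = a₀
    · exact Or.inl h0
    by_cases h1 : v = a₁
    · exact Or.inr h1
    rcases hS' v hv h0 h1 with rfl | rfl
    · exact absurd hr h2
    · exact absurd hr h3
  have h1 : Rch F a₀ a₁ := rch_a1 G ha₀ hreach hF
  have hF' := hF
  rw [mem_tJoins_univ] at hF'
  obtain ⟨hFG, hFodd⟩ := hF'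
  rw [mem_clusterIndex]
  refine ⟨(clusterEdges_subset F a₀).trans hFG, clusterEdges_idem F a₀, fun v => ?_, ?_, ?_⟩
  · by_cases hv : Rch F a₀ v
    · rw [odd_edeg_clusterEdges_iff hv, hFodd v, mem_insert, mem_singleton]
      exact ⟨fun hvS => hreach v hvS hv, fun h => h.elim (fun h => h ▸ ha₀) (fun h => h ▸ ha₁)⟩
    · rw [edeg_clusterEdges_eq_zero hv, mem_insert, mem_singleton]
      constructor
      · intro h; exact absurd h Nat.not_odd_zero
      · rintro (rfl | rfl)
        · exact absurd (rch_refl F v) hv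
        · exact absurd h1 hv
  · rwa [rch_clusterEdges_iff]
  · rwa [rch_clusterEdges_iff]

/-- **Outer decomposition**: a clean sum over `T`-joins is a sum over the cluster index set of
fibre sums. [folklore] -/
theorem sum_clean_eq_sum_fibres {S' : Finset V} {a₀ a₁ a₂ a₃ : V}
    (ha₀ : a₀ ∈ S') (ha₁ : a₁ ∈ S') (hS' : ∀ v ∈ S', v ≠ a₀ → v ≠ a₁ → v = a₂ ∨ v = a₃)
    (g : Finset (Sym2 V) → ℝ) :
    ∑ F ∈ (tJoins G Set.univ S').filter (fun F => ¬ Rch F a₀ a₂ ∧ ¬ Rch F a₀ a₃), g F =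
      ∑ K ∈ clusterIndex G a₀ a₁ a₂ a₃,
        ∑ F ∈ (tJoins G Set.univ S').filter (fun F => clusterEdges F a₀ = K), g F := by
  have hmaps : ∀ F ∈ (tJoins G Set.univ S').filter (fun F => ¬ Rch F a₀ a₂ ∧ ¬ Rch F a₀ a₃),
      clusterEdges F a₀ ∈ clusterIndex G a₀ a₁ a₂ a₃ := by
    intro F hF
    rw [mem_filter] at hF
    exact clusterEdges_mem_clusterIndex G ha₀ ha₁ hS' hF.1 hF.2.1 hF.2.2
  rw [← Finset.sum_fiberwise_of_maps_to hmaps g]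
  refine Finset.sum_congr rfl fun K hK => ?_
  apply Finset.sum_congr ?_ (fun _ _ => rfl)
  obtain ⟨-, -, -, hK2, hK3⟩ := (mem_clusterIndex G).1 hK
  ext F
  simp only [mem_filter]
  constructor
  · rintro ⟨⟨hF, -⟩, hcl⟩; exact ⟨hF, hcl⟩
  · rintro ⟨hF, hcl⟩
    refine ⟨⟨hF, ?_, ?_⟩, hcl⟩
    · rw [← rch_clusterEdges_iff, hcl]; exact hK2
    · rw [← rch_clusterEdges_iff, hcl]; exact hK3

/-- **Fibre evaluation, pair side**: over the fibre of `K`, `Σ t^|F| ⟨σ₂σ₃⟩_{depl F} = t^|K| · g_Λ({a₂,a₃})`. [folklore] -/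
theorem fibre_pair_side {a₀ a₁ a₂ a₃ : V} {K : Finset (Sym2 V)}
    (hK : K ∈ clusterIndex G a₀ a₁ a₂ a₃) (β : ℝ) :
    ∑ F ∈ (tJoins G Set.univ {a₀, a₁}).filter (fun F => clusterEdges F a₀ = K),
        Real.tanh β ^ F.card * isingCorr G (dVol F a₀) β 0 .free {a₂, a₃} =
      Real.tanh β ^ K.card * hteSum G (dVol K a₀) (Real.tanh β) {a₂, a₃} := by
  obtain ⟨hKG, hKself, hKodd, hK2, hK3⟩ := (mem_clusterIndex G).1 hK
  have hfib := fibre_sum G hKG hKself hKodd (T := ∅) (empty_subset _)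
    (fun F => Real.tanh β ^ F.card * isingCorr G (dVol F a₀) β 0 .free {a₂, a₃})
  rw [union_empty] at hfib
  rw [hfib]
  set Λ := dVol K a₀ with hΛ
  have hA : ({a₂, a₃} : Finset V) ⊆ Λ := by
    intro v hv
    rw [mem_insert, mem_singleton] at hv
    rcases hv with rfl | rfl
    · exact mem_dVol.2 hK2
    · exact mem_dVol.2 hK3
  have hne : hteSum G Λ (Real.tanh β) ∅ ≠ 0 := (hteSum_empty_pos G Λ β).ne'
  have hsummand : ∀ R ∈ (edgesIn G Λ).powerset.filter (fun R => oddVerts Λ R = ∅),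
      Real.tanh β ^ (K ∪ R).card * isingCorr G (dVol (K ∪ R) a₀) β 0 .free {a₂, a₃} =
        Real.tanh β ^ K.card * (hteSum G Λ (Real.tanh β) {a₂, a₃} / hteSum G Λ (Real.tanh β) ∅) *
          Real.tanh β ^ R.card := by
    intro R hR
    rw [mem_filter, mem_powerset] at hR
    have havoid : ∀ e ∈ R, ∀ v ∈ e, ¬ Rch K a₀ v := fun e he v hv =>
      mem_dVol.1 ((mem_edgesIn_iff.1 (hR.1 he)).2 v hv)
    rw [dVol_union_eq havoid, card_union_of_disjoint (disjoint_of_avoid hKself havoid), pow_add,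
      ← hΛ, isingCorr_free_eq_hteSum_div G Λ β hA]
    ring
  rw [Finset.sum_congr rfl hsummand, ← Finset.mul_sum]
  have hZ : ∑ R ∈ (edgesIn G Λ).powerset.filter (fun R => oddVerts Λ R = ∅), Real.tanh β ^ R.card =
      hteSum G Λ (Real.tanh β) ∅ := rfl
  rw [hZ]
  field_simp

/-- **Fibre evaluation, four-source side**: `Σ t^|F| = t^|K| · g_Λ({a₂,a₃})`. [folklore] -/
theorem fibre_four_side {a₀ a₁ a₂ a₃ : V} {K : Finset (Sym2 V)}
    (hK : K ∈ clusterIndex G a₀ a₁ a₂ a₃) (t : ℝ) :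
    ∑ F ∈ (tJoins G Set.univ ({a₀, a₁} ∪ {a₂, a₃})).filter (fun F => clusterEdges F a₀ = K),
        t ^ F.card = t ^ K.card * hteSum G (dVol K a₀) t {a₂, a₃} := by
  obtain ⟨hKG, hKself, hKodd, hK2, hK3⟩ := (mem_clusterIndex G).1 hK
  have hT : ({a₂, a₃} : Finset V) ⊆ dVol K a₀ := by
    intro v hv
    rw [mem_insert, mem_singleton] at hv
    rcases hv with rfl | rfl
    · exact mem_dVol.2 hK2
    · exact mem_dVol.2 hK3
  rw [fibre_sum G hKG hKself hKodd hT (fun F => t ^ F.card)]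
  have hsummand : ∀ R ∈ (edgesIn G (dVol K a₀)).powerset.filter (fun R => oddVerts (dVol K a₀) R = {a₂, a₃}),
      t ^ (K ∪ R).card = t ^ K.card * t ^ R.card := by
    intro R hR
    rw [mem_filter, mem_powerset] at hR
    have havoid : ∀ e ∈ R, ∀ v ∈ e, ¬ Rch K a₀ v := fun e he v hv =>
      mem_dVol.1 ((mem_edgesIn_iff.1 (hR.1 he)).2 v hv)
    rw [card_union_of_disjoint (disjoint_of_avoid hKself havoid), pow_add]
  rw [Finset.sum_congr rfl hsummand, ← Finset.mul_sum]
  rfl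

/-- **(★), abstract form.** [folklore] -/
theorem pairSplit_identity (a₀ a₁ a₂ a₃ : V) (β : ℝ) :
    ∑ F ∈ (tJoins G Set.univ {a₀, a₁}).filter (fun F => ¬ Rch F a₀ a₂ ∧ ¬ Rch F a₀ a₃),
        Real.tanh β ^ F.card * isingCorr G (dVol F a₀) β 0 .free {a₂, a₃} =
      ∑ F ∈ (tJoins G Set.univ ({a₀, a₁} ∪ {a₂, a₃})).filter (fun F => ¬ Rch F a₀ a₂ ∧ ¬ Rch F a₀ a₃),
        Real.tanh β ^ F.card := by
  have hS₁ : ∀ v ∈ ({a₀, a₁} : Finset V), v ≠ a₀ → v ≠ a₁ → v = a₂ ∨ v = a₃ := by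
    intro v hv h0 h1
    rw [mem_insert, mem_singleton] at hv
    rcases hv with rfl | rfl
    · exact absurd rfl h0
    · exact absurd rfl h1
  have hS₂ : ∀ v ∈ ({a₀, a₁} ∪ {a₂, a₃} : Finset V), v ≠ a₀ → v ≠ a₁ → v = a₂ ∨ v = a₃ := by
    intro v hv h0 h1
    rw [mem_union, mem_insert, mem_singleton, mem_insert, mem_singleton] at hv
    rcases hv with (rfl | rfl) | h
    · exact absurd rfl h0
    · exact absurd rfl h1
    · exact h
  rw [sum_clean_eq_sum_fibres G (by simp) (by simp) hS₁,
    sum_clean_eq_sum_fibres G (by simp) (by simp) hS₂]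
  refine Finset.sum_congr rfl fun K hK => ?_
  rw [fibre_pair_side G hK, fibre_four_side G hK]

end Assembly

/-! ### LoopO1 ↔ HT-expansion bridges (`Z^A = g_univ(A)`, `⟨σ_A⟩ = Z^A/Z^∅`) -/

section Bridge

variable {V : Type*} [Fintype V] [DecidableEq V] (G : SimpleGraph V) [DecidableRel G.Adj]

/-- `T`-joins of the whole graph = the index set of the high-temperature sum `g_univ(A)`:
LoopO1 vocabulary (`tJoins`) meets HT-expansion vocabulary (`edgesIn`, `oddVerts`). [folklore] -/
theorem tJoins_univ_eq_filter (A : Finset V) :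
    tJoins G Set.univ A = (edgesIn G Finset.univ).powerset.filter (fun F => oddVerts Finset.univ F = A) := by
  ext F
  rw [mem_tJoins, mem_filter, mem_powerset]
  simp only [Set.subset_univ, true_and]
  constructor
  · rintro ⟨hFG, hodd⟩
    refine ⟨fun e he => ?_, ?_⟩
    · rw [mem_edgesIn_iff]
      exact ⟨SimpleGraph.mem_edgeFinset.1 (hFG he), fun x _ => mem_univ x⟩
    · ext v
      rw [oddVerts, mem_filter]
      simp only [mem_univ, true_and]
      exact hodd v
  · rintro ⟨hFE, hodd⟩
    refine ⟨fun e he => SimpleGraph.mem_edgeFinset.2 (mem_edgesIn_iff.1 (hFE he)).1, fun v => ?_⟩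
    have := Finset.ext_iff.1 hodd v
    rw [oddVerts, mem_filter] at this
    simpa only [mem_univ, true_and] using this

/-- **`Z^A_t(G) = g_univ(A)`**: the sourced loop-O(1) partition function of `LoopO1.lean` is the
high-temperature generating sum of `ModifiedSimonInequality.lean` over the whole vertex set. [folklore] -/
theorem loopO1PartitionFunction_eq_hteSum (t : ℝ) (A : Finset V) :
    loopO1PartitionFunction G t A = hteSum G Finset.univ t A := by
  unfold loopO1PartitionFunction loopO1Weight hteSum
  rw [← Finset.sum_filter]
  congr 1
  rw [← tJoins_univ_eq_filter]
  ext F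
  simp only [mem_filter, mem_powerset, and_iff_right_iff_imp]
  intro hF
  exact ((mem_tJoins G).1 hF).1

/-- **High-temperature expansion in loop-O(1) dress**: `⟨σ_A⟩^free_{G;β,0} = Z^A_{tanh β}(G) / Z^∅_{tanh β}(G)`
for every `A` (the route's dictionary step "⟨σxσy⟩^free = Z^{xy}/Z⁰", for all source sets at once). [folklore] -/
theorem isingCorr_univ_free_eq_loopO1_div (β : ℝ) (A : Finset V) :
    isingCorr G Finset.univ β 0 .free A =
      loopO1PartitionFunction G (Real.tanh β) A / loopO1PartitionFunction G (Real.tanh β) ∅ := by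
  rw [loopO1PartitionFunction_eq_hteSum, loopO1PartitionFunction_eq_hteSum,
    isingCorr_free_eq_hteSum_div G Finset.univ β (Finset.subset_univ A)]

/-- `Z^∅_{tanh β}(G) > 0`. [folklore] -/
theorem loopO1PartitionFunction_empty_pos' (β : ℝ) :
    0 < loopO1PartitionFunction G (Real.tanh β) ∅ := by
  rw [loopO1PartitionFunction_eq_hteSum]; exact hteSum_empty_pos G _ β

/-- `Z^A_t(G)` as the plain sum over `T`-joins. [folklore] -/
theorem loopO1PartitionFunction_eq_sum_tJoins (t : ℝ) (A : Finset V) :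
    loopO1PartitionFunction G t A = ∑ F ∈ tJoins G Set.univ A, t ^ F.card := by
  unfold loopO1PartitionFunction loopO1Weight
  rw [← Finset.sum_filter]
  congr 1
  ext F
  simp only [mem_filter, mem_powerset, and_iff_right_iff_imp]
  intro hF
  exact ((mem_tJoins G).1 hF).1

end Bridge


/-! ### (★) in the route's `Fin 4` dress -/

section Dress

variable {V : Type*} [Fintype V] [DecidableEq V] (G : SimpleGraph V) [DecidableRel G.Adj]

/-- **(★) in the route's dress**: for `a : Fin 4 → V` and real `β` (`t = tanh β`),
`Σ_{F ∈ 𝒯₀₁(G), a₂,a₃ ∉ V(K_{a₀}F)} t^|F| · ⟨σ_{a₂}σ_{a₃}⟩^free_{G, V ∖ V(K_{a₀}F)}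
   = Σ_{F ∈ 𝒯_{image a}(G), a₂,a₃ ∉ V(K_{a₀}F)} t^|F|` — the configurations of ONE sourced
critical strand, weighted by the depleted free pair correlation of the other pair, are the
four-source configurations split as `01|23`.  (No injectivity or sign hypothesis is needed.)
Instance note for users at the crux: the crux body carries classical `Finset.filter` instances —
transport this constructive statement with `convert … using 4; ext v; simp [dVol]`. [folklore] -/
theorem pairSplit_identity_fin4 (β : ℝ) (a : Fin 4 → V) :
    (∑ F ∈ (tJoins G Set.univ {a 0, a 1}).filter (fun F : Finset (Sym2 V) =>
        ¬ (SimpleGraph.fromEdgeSet (↑F : Set (Sym2 V))).Reachable (a 0) (a 2) ∧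
        ¬ (SimpleGraph.fromEdgeSet (↑F : Set (Sym2 V))).Reachable (a 0) (a 3)),
        Real.tanh β ^ F.card * isingCorr G (Finset.univ.filter fun v : V =>
          ¬ (SimpleGraph.fromEdgeSet (↑F : Set (Sym2 V))).Reachable (a 0) v) β 0 .free {a 2, a 3})
      = ∑ F ∈ (tJoins G Set.univ (Finset.univ.image a)).filter (fun F : Finset (Sym2 V) =>
          ¬ (SimpleGraph.fromEdgeSet (↑F : Set (Sym2 V))).Reachable (a 0) (a 2) ∧
          ¬ (SimpleGraph.fromEdgeSet (↑F : Set (Sym2 V))).Reachable (a 0) (a 3)),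
          Real.tanh β ^ F.card := by
  have himg : (Finset.univ.image a : Finset V) = {a 0, a 1} ∪ {a 2, a 3} := by
    ext v
    simp only [Finset.mem_image, Finset.mem_univ, true_and, Finset.mem_union, Finset.mem_insert,
      Finset.mem_singleton]
    constructor
    · rintro ⟨i, rfl⟩
      fin_cases i <;> simp
    · rintro ((rfl | rfl) | (rfl | rfl)) <;> exact ⟨_, rfl⟩
  rw [himg]
  exact pairSplit_identity G (a 0) (a 1) (a 2) (a 3) β

/-- **Discharge of the named fact `Literature.Uncategorized.PairSplitDeletionIdentity`** (the
gate's accept-time relocation of this file's first version): it is `pairSplit_identity_fin4`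
(the `0 ≤ β` and injectivity hypotheses of the fact are not even needed). -/
theorem pairSplitDeletionIdentity_holds : Literature.Uncategorized.PairSplitDeletionIdentity := by
  intro V _ _ G _ β _ a _
  exact pairSplit_identity_fin4 G β a

end Dress


end Summit.CriticalPhenomena.Ising3DConformalLimit.StrandShadowNegative

end
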